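import Summits.CriticalPhenomena.SAWScalingLimit.Theses.SAWReversalUpgrade
import Summits.CriticalPhenomena.SAWScalingLimit.Theorems.SAWReversalUpgradeForwardDrivingDrivingCoupling
import Summits.CriticalPhenomena.SAWScalingLimit.Theorems.SAWReversalUpgradeForwardDrivingLawOfCoupling
import Summits.CriticalPhenomena.SAWScalingLimit.Theorems.SAWReversalUpgradeForwardDrivingKeyEstimateOfSampled
import Summits.CriticalPhenomena.SAWScalingLimit.Theorems.SAWReversalUpgradeForwardDrivingSampledOfGerm
import Literature.Probability.RandomPlanarGeometry.DrivingConvergenceEngine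
import Literature.Probability.RandomPlanarGeometry.DrivingGermSampling
import HarnessLib

/-!
# Line `lsw-engine` for the crux `ForwardDriving` (stmt-CriticalPhenomena-18003, route SAWReversalUpgrade)

Strategist line (crux-strategist before the lead, 2026-08-17). ForwardDriving = convergence in law, on every
`[0, T]`, of the Loewner driving function (through a chordal uniformizer `φ`) of the canonically
boundary-attached critical SAW `att(γ_δ)` to `√(8/3) B`.

THE CUT — the Lawler–Schramm–Werner normal form, with NO tightness / subsequential-limit step. The tree
already contains LSW04 §3.3 as an abstract engine (`Literature/…/DrivingConvergenceEngine.lean`: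
`SkorokhodEmbedding.RawDrivingData`, `RawDrivingData.IsValid`, `exists_delta_forall_coupling_lt`, general κ):
raw driving data = a finite filtered probability space (here: the SAW space `DomainSAW` with `SAW.law` and the
prefix filtration read at mesoscopic stopping indices), adapted capacities / driving values / the sample
driving function, and the two ATOMWISE key estimates `|E[ΔW | 𝓕_k]| ≤ C₁ δ'³`, `|E[(ΔW)² − κ Δt | 𝓕_k]| ≤ C₂ δ'³`
(κ = 8/3), increments `≤ 2δ'`, `≤ 2δ'²`, data frozen from a truncation index on; the engine returns, for δ'
small, a COUPLING of the law of the driving function with the law of `t ↦ B(κ t)` that charges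
`{sup_{t ≤ T} |W − B(κ·)| > ε₂}` by `< ε₃ + P(truncation before the horizon)`.

* S1 `stub_mesoscopicKeyEstimate` (THE CRUX CONTENT, open-problem): for every (D; a, b), endpoint
  approximation, chordal uniformizer, eventually-standard attachment and horizon `T`, such raw driving data
  exist for the attached critical SAW with `κ = 8/3`, mesoscopic scale `→ 0`, truncation probability `→ 0`,
  eventual validity with `(8/3+2)T+1 ≤ N δ'² ≤ (8/3+2)T+2`. Where it comes from (the strategist's crux idea
  `target-change-rn`, Cruxes/ForwardDriving/Ideas/): an EXACT SAW martingale observable — the change-of-target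
  Radon–Nikodym supermartingale `L_n(z) = P^{a→z}(prefix)/P^{a→b}(prefix)` for auxiliary targets `z` near `b`
  — whose asymptotics `L_n(z) ≈ [ẑ² g_n'(ẑ)/(g_n(ẑ) − W_n)²]^{5/8}` (Kennedy–Lawler boundary covariance,
  exponent 5/8 = h₁,₂ at c = 0) expanded to second order in `1/ẑ` give `W` and `W² − (8/3)t` as approximate
  martingales (LSW04 §3.2 recipe, two observation points); truncation at an early rush to `b` / deep return
  to `a` (the attachment is adapted only off those events).
* S2 `stub_drivingCoupling` (M, provable now): raw data as in S1 ⇒ for all `ε₂ ε₃ > 0`, eventually in δ, a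
  coupling `ρ` of `law.map W` with `wienerLawC.map (timeScale (8/3))` charging `{∃ t ≤ T, ε₂ < |W t − B(8t/3)|}`
  by `< ε₃` (`RawDrivingData.isValid_toDrivingData`, `exists_delta_forall_coupling_lt` with `ε₃/2`,
  `toDrivingData_lowerFailSet`; `Nonempty`/`MeasurableSingletonClass` of the SAW space from `IsValid.prob` / `⊤`).
* S3 `stub_lawOfCoupling` (L, provable now): such couplings ⇒ the `TendstoLaw` conclusion of ForwardDriving
  at `T` (restriction `C(ℝ≥0,ℝ) → C(Icc 0 T, ℝ)` is continuous; Slutsky: a bounded continuous test function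
  is uniformly continuous near a compact set carrying `1 − ε` of the FIXED scaled Wiener law; Brownian scaling
  `t ↦ B(8t/3)` =ᵈ `√(8/3) B` = `sleDriving (8/3)`, cf. `identDistrib_sleDriving_scale'`,
  `wienerLawC_map_timeScale_eight`).

`ForwardDriving_of : ForwardDriving` is the instance-wise composition S3 ∘ S2 ∘ S1, using the stubs by name (kernel-checked below).

LEAD'S RESHAPE (2026-08-17, cycle 1): S2, S3 LANDED (p158449, p159272) and imported; the glue
`ForwardDriving_of_keyEstimate : S1 → ForwardDriving` landed (p159773); S1 is now PROVED from its SAMPLED FORM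
S1″ `stub_sampledKeyEstimate` (the only `sorry` left) by `keyEstimate_of_sampled` (p160218, via the Literature
file `DrivingCapacitySampling.lean`, p159382: LSW stopping capacities `capStop`, `sampledData`,
`sampledData_isValid`, `sampledData_lowerFailSet_subset`). S1″ pins the raw data to the canonical capacity
sampling of the attached walk's driving function frozen at a truncation index, so the open content is exactly:
refining countable histories determining the curve up to the current stop, the two atomwise conditional-moment
bounds, and `P(truncation before the horizon) → 0` (a uniform no-deep-return to the access segment at `a`).
Why this dodges the stuck goals of the birth line (`stub_tightDriving`, `stub_identifyDrivingLimits`): no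
C-tightness of `W^δ`, no subsequential limit objects, no describability/martingale passage in the limit are
needed — the engine works at finite δ with a coupling; ALL open content is concentrated in S1, a statement
about conditional moments of the finite SAW measure.

LEAD'S RESHAPE (c1, 2026-08-17, cycle 1): S1″ is now PROVED from its GERM NORMAL FORM S1♮
`stub_germKeyEstimate` by the glue `stub_sampledOfGerm` (G1, LANDED p163126: canonical germ codes +
canonical truncation at the first violating germ atom, `Literature/…/DrivingGermSampling.lean`, p162690). S1♮ has no
label type `Λ`, no histories `H`, no truncation index `τ` and no adaptedness / causality clause left: it says
that, with `SAW.law`-probability `→ 1` as `δ → 0`, along the GERM filtration of its own capacity-sampled driving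
function (atom of `γ` at step `k` = the walks whose attached driving function agrees with that of `γ` up to the
`k`-th stopping capacity), the attached walk's driving increments have conditional mean `O(dm³)` and conditional
second moment `(8/3)·Δt + O(dm³)` at every step below the horizon `N δ ≈ (14/3)T/dm²`. Every history-based
(domain-Markov) form of the LSW key estimate implies S1♮ by the tower property and Markov's inequality; S1♮ is
the weakest statement the engine consumes.

References: Lawler–Schramm–Werner, Ann. Probab. 32 (2004) §3.2–3.3, Thm 3.7 [LawlerSchrammWerner2004];
Lawler–Schramm–Werner, Proc. Sympos. Pure Math. 72 (2004) §2.1, §4.1 [LawlerSchrammWerner2004SAW];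
Kennedy–Lawler, Lattice effects in the scaling limit of the 2D SAW (arXiv:1109.3091) [KennedyLawler2013];
Kennedy, J. Stat. Phys. 131 (2008) [Kennedy2008Driving]; Lawler–Schramm–Werner, JAMS 16 (2003) (restriction,
exponent 5/8) [LawlerSchrammWerner2003Restriction].
-/

noncomputable section

namespace Summit.CriticalPhenomena.SAWScalingLimit.Cruxes.ForwardDriving.LswEngine

open scoped BigOperators Topology Classical MeasureTheory ProbabilityTheory NNReal ENNReal
open scoped Literature.Probability.RandomPlanarGeometry.PathBorel
open Filter Set Function TopologicalSpace MeasureTheory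

/-- S1♮ `stub_germKeyEstimate` — THE OPEN CONTENT after the c1 reshape (open problem; the conformal-invariance
content of the crux in its weakest engine-ready form): for every Dobrushin domain, endpoint approximation, chordal
uniformizer, eventually-standard attachment and horizon `T` there are constants `C₁, C₂ ≥ 0`, a mesoscopic scale
`dm δ → 0` (`> 0`) and horizons `N δ` in the window `(8/3+2)T+1 ≤ N δ·dm δ² ≤ (8/3+2)T+2` such that the
`SAW.law`-probability of the following event tends to `0` as `δ → 0⁺`: at some step `k < N δ`, the GERM ATOM of
`γ` (the walks `γ'` whose attached driving function `W γ' = drivingFunction φ (mk (att δ γ'))` agrees with `W γ`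
on `[0, t_k γ]`, `t_k = capStop (W ·) (dm δ) k` the LSW stopping capacities) violates one of the two
Lawler–Schramm–Werner conditional-moment bounds `|E[ΔW_k ; A]| ≤ C₁ dm³ law(A)`,
`|E[(ΔW_k)² − (8/3)Δt_k ; A]| ≤ C₂ dm³ law(A)` (`ΔW_k = W(t_{k+1}) − W(t_k)`, `Δt_k = t_{k+1} − t_k`, untruncated).
The violation predicate is the tree's `SkorokhodEmbedding.germViol` (`Literature/…/DrivingGermSampling.lean`, p162690).
No histories, no truncation index, no adaptedness clause: those are manufactured by the glue G1 below.
[cite: LawlerSchrammWerner2004, Prop. 3.4, §3.3] [cite: KennedyLawler2013] -/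
theorem stub_germKeyEstimate :
    ∀ (D : Literature.Probability.RandomPlanarGeometry.DobrushinDomain) (a b : ℝ → Literature.Probability.LatticeModels.Site 2), Literature.Probability.RandomPlanarGeometry.SAW.IsEndpointApprox D a b → ∀ (φ : Literature.Probability.RandomPlanarGeometry.ConformalEquiv UpperHalfPlane.upperHalfPlaneSet D.carrier), D.IsChordalUniformizing φ → ∀ (att : ((δ : ℝ) → Literature.Probability.RandomPlanarGeometry.SAW.DomainSAW (D).carrier δ (a δ) (b δ) → Literature.Probability.RandomPlanarGeometry.Curve ℂ)), (∀ᶠ δ in (nhdsWithin (0:ℝ) (Set.Ioi 0)), ∀ γ : Literature.Probability.RandomPlanarGeometry.SAW.DomainSAW (D).carrier δ (a δ) (b δ), (let a₁ := (D).pt 0; let b₁ := (D).pt 1; let P₁ : C(unitInterval, ℂ) := (γ.walk.toCurve (Literature.Probability.LatticeModels.meshPoint δ)); let R₁ := fun u : ℝ => P₁ (Set.projIcc (0:ℝ) 1 zero_le_one u); let φ₁ := (φ).boundaryExtension; let ψ₁ := Function.invFunOn φ₁ {z : ℂ | 0 ≤ z.im}; let e₁ : ℝ := min δ (1/2); let A₁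 := fun z : ℂ => (‖z‖ : ℂ) * Complex.exp (Complex.I * ((e₁ : ℂ) + (1 - 2 * (e₁ : ℂ) / (Real.pi : ℂ)) * (Complex.arg z : ℂ))); let Z₁ := fun u : ℝ => @ite ℂ (R₁ u = b₁) (Classical.propDecidable _) b₁ (φ₁ (A₁ (ψ₁ (R₁ u)))); let i₁ := sSup ({(0:ℝ)} ∪ {u | u ∈ Set.Icc (0:ℝ) 1 ∧ R₁ u = a₁}); let j₁ := sInf ({(1:ℝ)} ∪ {u | u ∈ Set.Icc (0:ℝ) 1 ∧ R₁ u = b₁}); let M₁ := Z₁ '' Set.Icc i₁ j₁; let p₁ := A₁ (ψ₁ (R₁ i₁)); let q₁ := A₁ (ψ₁ (R₁ j₁)); let s₁ := sInf {s | s ∈ Set.Ioc (0:ℝ) 1 ∧ φ₁ ((s : ℂ) * p₁) ∈ M₁}; let r₁ := sSup ({(1:ℝ)} ∪ {r | 1 ≤ r ∧ R₁ j₁ ≠ b₁ ∧ φ₁ ((r : ℂ) * q₁) ∈ M₁}); let u₁ := sInf {u | u ∈ Set.Icc i₁ j₁ ∧ Z₁ u = φ₁ ((s₁ : ℂ) *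 p₁)}; let v₁ := sSup ({u | u ∈ Set.Icc i₁ j₁ ∧ R₁ j₁ = b₁ ∧ u = j₁} ∪ {u | u ∈ Set.Icc i₁ j₁ ∧ R₁ j₁ ≠ b₁ ∧ Z₁ u = φ₁ ((r₁ : ℂ) * q₁)}); let S₁ := ((({a₁, b₁} ∪ ((fun s : ℝ => φ₁ ((s : ℂ) * p₁)) '' Set.Ioc 0 s₁)) ∪ (Z₁ '' Set.Icc u₁ v₁)) ∪ ((fun r : ℝ => φ₁ ((r : ℂ) * q₁)) '' {r | r₁ ≤ r ∧ R₁ j₁ ≠ b₁})); Function.Injective (att δ γ) ∧ (att δ γ).source = a₁ ∧ (att δ γ).target = b₁ ∧ (∀ t : unitInterval, (att δ γ) t = a₁ ∨ (att δ γ) t = b₁ ∨ (att δ γ) t ∈ (D).carrier) ∧ (u₁ < v₁ → Set.range (att δ γ) = S₁) ∧ (¬ u₁ < v₁ → Set.range (att δ γ) = {a₁, b₁} ∪ ((fun y : ℝ => φ₁ (Complex.I * (y : ℂ))) '' Set.Ioi 0)))) → ∀ T : NNReal, (∃ (C₁ C₂ : ℝ) (dm : ℝ → ℝ) (N : ℝ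 → ℕ), 0 ≤ C₁ ∧ 0 ≤ C₂ ∧ Filter.Tendsto dm (nhdsWithin 0 (Set.Ioi 0)) (nhds 0) ∧ (∀ᶠ δ in nhdsWithin 0 (Set.Ioi 0), 0 < dm δ ∧ (8/3 + 2) * (T : ℝ) + 1 ≤ (N δ : ℝ) * (dm δ)^2 ∧ (N δ : ℝ) * (dm δ)^2 ≤ (8/3 + 2) * (T : ℝ) + 2) ∧ Filter.Tendsto (fun δ => Literature.Probability.RandomPlanarGeometry.SAW.law D.carrier δ (a δ) (b δ) {γ | ∃ k < N δ, Literature.Probability.RandomPlanarGeometry.SkorokhodEmbedding.germViol (Literature.Probability.RandomPlanarGeometry.SAW.law D.carrier δ (a δ) (b δ)) (fun γ' => (⟨Literature.Probability.RandomPlanarGeometry.drivingFunction φ (Literature.Probability.RandomPlanarGeometry.CurveClass.mk (att δ γ')), Literature.Probability.RandomPlanarGeometry.continuous_drivingFunction φ (Literature.Probability.RandomPlanarGeometry.CurveClass.mk (att δ γ'))⟩ : C(NNReal, ℝ))) (dm δ) (8/3) C₁ C₂ k γ}) (nhdsWithin 0 (Set.Ioi 0)) (nhds 0)) := by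
  sorry

/-! G1 `stub_sampledOfGerm` (glue): LANDED — `Theorems/SAWReversalUpgradeForwardDrivingSampledOfGerm.lean`
(p163126, `…LswEngine.stub_sampledOfGerm` : S1♮ → S1″, via `Literature/…/DrivingGermSampling.lean` p162690:
label type `Λ := ℕ`, history = code of the germ atom, truncation = first violating step,
`germ_sampledData_isValid`, `setOf_germTrunc_lt`), imported above. -/

/-- S1″ `stub_sampledKeyEstimate` (registered open stub of cycle a0) — now PROVED from its germ normal form S1♮
by the glue G1 (the source clause `(att δ γ).source = D.pt 0` is the second conjunct of the standard-attachment
hypothesis). [cite: LawlerSchrammWerner2004, Prop. 3.4, §3.3] -/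
theorem stub_sampledKeyEstimate :
    ∀ (D : Literature.Probability.RandomPlanarGeometry.DobrushinDomain) (a b : ℝ → Literature.Probability.LatticeModels.Site 2), Literature.Probability.RandomPlanarGeometry.SAW.IsEndpointApprox D a b → ∀ (φ : Literature.Probability.RandomPlanarGeometry.ConformalEquiv UpperHalfPlane.upperHalfPlaneSet D.carrier), D.IsChordalUniformizing φ → ∀ (att : ((δ : ℝ) → Literature.Probability.RandomPlanarGeometry.SAW.DomainSAW (D).carrier δ (a δ) (b δ) → Literature.Probability.RandomPlanarGeometry.Curve ℂ)), (∀ᶠ δ in (nhdsWithin (0:ℝ) (Set.Ioi 0)), ∀ γ : Literature.Probability.RandomPlanarGeometry.SAW.DomainSAW (D).carrier δ (a δ) (b δ), (let a₁ := (D).pt 0; let b₁ := (D).pt 1; let P₁ : C(unitInterval, ℂ) := (γ.walk.toCurve (Literature.Probability.LatticeModels.meshPoint δ)); let R₁ := fun u : ℝ => P₁ (Set.projIcc (0:ℝ) 1 zero_le_one u); let φ₁ := (φ).boundaryExtension; let ψ₁ := Function.invFunOn φ₁ {z : ℂ | 0 ≤ z.im}; let e₁ : ℝ := min δ (1/2);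 let A₁ := fun z : ℂ => (‖z‖ : ℂ) * Complex.exp (Complex.I * ((e₁ : ℂ) + (1 - 2 * (e₁ : ℂ) / (Real.pi : ℂ)) * (Complex.arg z : ℂ))); let Z₁ := fun u : ℝ => @ite ℂ (R₁ u = b₁) (Classical.propDecidable _) b₁ (φ₁ (A₁ (ψ₁ (R₁ u)))); let i₁ := sSup ({(0:ℝ)} ∪ {u | u ∈ Set.Icc (0:ℝ) 1 ∧ R₁ u = a₁}); let j₁ := sInf ({(1:ℝ)} ∪ {u | u ∈ Set.Icc (0:ℝ) 1 ∧ R₁ u = b₁}); let M₁ := Z₁ '' Set.Icc i₁ j₁; let p₁ := A₁ (ψ₁ (R₁ i₁)); let q₁ := A₁ (ψ₁ (R₁ j₁)); let s₁ := sInf {s | s ∈ Set.Ioc (0:ℝ) 1 ∧ φ₁ ((s : ℂ) * p₁) ∈ M₁}; let r₁ := sSup ({(1:ℝ)} ∪ {r | 1 ≤ r ∧ R₁ j₁ ≠ b₁ ∧ φ₁ ((r : ℂ) * q₁) ∈ M₁}); let u₁ := sInf {u | u ∈ Set.Icc i₁ j₁ ∧ Z₁ u = φ₁ ((s₁ : ℂ)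 * p₁)}; let v₁ := sSup ({u | u ∈ Set.Icc i₁ j₁ ∧ R₁ j₁ = b₁ ∧ u = j₁} ∪ {u | u ∈ Set.Icc i₁ j₁ ∧ R₁ j₁ ≠ b₁ ∧ Z₁ u = φ₁ ((r₁ : ℂ) * q₁)}); let S₁ := ((({a₁, b₁} ∪ ((fun s : ℝ => φ₁ ((s : ℂ) * p₁)) '' Set.Ioc 0 s₁)) ∪ (Z₁ '' Set.Icc u₁ v₁)) ∪ ((fun r : ℝ => φ₁ ((r : ℂ) * q₁)) '' {r | r₁ ≤ r ∧ R₁ j₁ ≠ b₁})); Function.Injective (att δ γ) ∧ (att δ γ).source = a₁ ∧ (att δ γ).target = b₁ ∧ (∀ t : unitInterval, (att δ γ) t = a₁ ∨ (att δ γ) t = b₁ ∨ (att δ γ) t ∈ (D).carrier) ∧ (u₁ < v₁ → Set.range (att δ γ) = S₁) ∧ (¬ u₁ < v₁ → Set.range (att δ γ) = {a₁, b₁} ∪ ((fun y : ℝ => φ₁ (Complex.I * (y : ℂ))) '' Set.Ioi 0)))) → ∀ T : NNReal, (∃ (Λ : Type) (_ : DecidableEq Λ) (_ : MeasurableSpace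 Λ) (_ : Countable Λ) (_ : MeasurableSingletonClass Λ) (C₁ C₂ : ℝ) (dm : ℝ → ℝ) (H : (δ : ℝ) → ℕ → Literature.Probability.RandomPlanarGeometry.SAW.DomainSAW D.carrier δ (a δ) (b δ) → Λ) (τ : (δ : ℝ) → Literature.Probability.RandomPlanarGeometry.SAW.DomainSAW D.carrier δ (a δ) (b δ) → ℕ) (N : ℝ → ℕ), 0 ≤ C₁ ∧ 0 ≤ C₂ ∧ Filter.Tendsto dm (nhdsWithin 0 (Set.Ioi 0)) (nhds 0) ∧ Filter.Tendsto (fun δ => Literature.Probability.RandomPlanarGeometry.SAW.law D.carrier δ (a δ) (b δ) {γ | τ δ γ < N δ}) (nhdsWithin 0 (Set.Ioi 0)) (nhds 0) ∧ ∀ᶠ δ in nhdsWithin 0 (Set.Ioi 0), ∃ (_ : Fintype (Literature.Probability.RandomPlanarGeometry.SAW.DomainSAW D.carrier δ (a δ) (b δ))), (Literature.Probability.RandomPlanarGeometry.SkorokhodEmbedding.sampledData (Literature.Probability.RandomPlanarGeometry.SAW.law D.carrier δ (a δ) (b δ)) (H δ) (fun γ => (⟨Literature.Probability.RandomPlanarGeometry.drivingFunction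 φ (Literature.Probability.RandomPlanarGeometry.CurveClass.mk (att δ γ)), Literature.Probability.RandomPlanarGeometry.continuous_drivingFunction φ (Literature.Probability.RandomPlanarGeometry.CurveClass.mk (att δ γ))⟩ : C(NNReal, ℝ))) (τ δ) (dm δ) (8/3) C₁ C₂).IsValid (N δ) ∧ (8/3 + 2) * (T : ℝ) + 1 ≤ (N δ : ℝ) * (dm δ)^2 ∧ (N δ : ℝ) * (dm δ)^2 ≤ (8/3 + 2) * (T : ℝ) + 2) :=
  fun D a b happ φ hφ att hatt T =>
    stub_sampledOfGerm D a b happ φ hφ att T (hatt.mono fun _ h γ => (h γ).2.1)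
      (stub_germKeyEstimate D a b happ φ hφ att hatt T)

/-- S1 `stub_mesoscopicKeyEstimate` (the originally registered open stub) — now PROVED from its sampled form
S1″ by `keyEstimate_of_sampled` (Theorems/SAWReversalUpgradeForwardDrivingKeyEstimateOfSampled.lean).
[cite: LawlerSchrammWerner2004, Prop. 3.4, §3.3] -/
theorem stub_mesoscopicKeyEstimate :
    ∀ (D : Literature.Probability.RandomPlanarGeometry.DobrushinDomain) (a b : ℝ → Literature.Probability.LatticeModels.Site 2), Literature.Probability.RandomPlanarGeometry.SAW.IsEndpointApprox D a b → ∀ (φ : Literature.Probability.RandomPlanarGeometry.ConformalEquiv UpperHalfPlane.upperHalfPlaneSet D.carrier), D.IsChordalUniformizing φ → ∀ (att : ((δ : ℝ) → Literature.Probability.RandomPlanarGeometry.SAW.DomainSAW (D).carrier δ (a δ) (b δ) → Literature.Probability.RandomPlanarGeometry.Curve ℂ)), (∀ᶠ δ in (nhdsWithin (0:ℝ) (Set.Ioi 0)), ∀ γ : Literature.Probability.RandomPlanarGeometry.SAW.DomainSAW (D).carrier δ (a δ) (b δ), (let a₁ := (D).pt 0; let b₁ := (D).pt 1; let P₁ :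 C(unitInterval, ℂ) := (γ.walk.toCurve (Literature.Probability.LatticeModels.meshPoint δ)); let R₁ := fun u : ℝ => P₁ (Set.projIcc (0:ℝ) 1 zero_le_one u); let φ₁ := (φ).boundaryExtension; let ψ₁ := Function.invFunOn φ₁ {z : ℂ | 0 ≤ z.im}; let e₁ : ℝ := min δ (1/2); let A₁ := fun z : ℂ => (‖z‖ : ℂ) * Complex.exp (Complex.I * ((e₁ : ℂ) + (1 - 2 * (e₁ : ℂ) / (Real.pi : ℂ)) * (Complex.arg z : ℂ))); let Z₁ := fun u : ℝ => @ite ℂ (R₁ u = b₁) (Classical.propDecidable _) b₁ (φ₁ (A₁ (ψ₁ (R₁ u)))); let i₁ := sSup ({(0:ℝ)} ∪ {u | u ∈ Set.Icc (0:ℝ) 1 ∧ R₁ u = a₁}); let j₁ := sInf ({(1:ℝ)} ∪ {u | u ∈ Set.Icc (0:ℝ) 1 ∧ R₁ u = b₁}); let M₁ := Z₁ '' Set.Icc i₁ j₁; let p₁ := A₁ (ψ₁ (R₁ i₁)); let q₁ := A₁ (ψ₁ (R₁ j₁)); let s₁ := sInf {s | s ∈ Set.Ioc (0:ℝ) 1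 ∧ φ₁ ((s : ℂ) * p₁) ∈ M₁}; let r₁ := sSup ({(1:ℝ)} ∪ {r | 1 ≤ r ∧ R₁ j₁ ≠ b₁ ∧ φ₁ ((r : ℂ) * q₁) ∈ M₁}); let u₁ := sInf {u | u ∈ Set.Icc i₁ j₁ ∧ Z₁ u = φ₁ ((s₁ : ℂ) * p₁)}; let v₁ := sSup ({u | u ∈ Set.Icc i₁ j₁ ∧ R₁ j₁ = b₁ ∧ u = j₁} ∪ {u | u ∈ Set.Icc i₁ j₁ ∧ R₁ j₁ ≠ b₁ ∧ Z₁ u = φ₁ ((r₁ : ℂ) * q₁)}); let S₁ := ((({a₁, b₁} ∪ ((fun s : ℝ => φ₁ ((s : ℂ) * p₁)) '' Set.Ioc 0 s₁)) ∪ (Z₁ '' Set.Icc u₁ v₁)) ∪ ((fun r : ℝ => φ₁ ((r : ℂ) * q₁)) '' {r | r₁ ≤ r ∧ R₁ j₁ ≠ b₁})); Function.Injective (att δ γ) ∧ (att δ γ).source = a₁ ∧ (att δ γ).target = b₁ ∧ (∀ t : unitInterval, (att δ γ) t = a₁ ∨ (att δ γ) t = b₁ ∨ (att δ γ) t ∈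 (D).carrier) ∧ (u₁ < v₁ → Set.range (att δ γ) = S₁) ∧ (¬ u₁ < v₁ → Set.range (att δ γ) = {a₁, b₁} ∪ ((fun y : ℝ => φ₁ (Complex.I * (y : ℂ))) '' Set.Ioi 0)))) → ∀ T : NNReal, (∃ (Λ : Type) (_ : DecidableEq Λ) (_ : MeasurableSpace Λ) (_ : Countable Λ) (_ : MeasurableSingletonClass Λ) (C₁ C₂ : ℝ) (RD : (δ : ℝ) → Literature.Probability.RandomPlanarGeometry.SkorokhodEmbedding.RawDrivingData (Literature.Probability.RandomPlanarGeometry.SAW.DomainSAW D.carrier δ (a δ) (b δ)) Λ) (N : ℝ → ℕ), 0 ≤ C₁ ∧ 0 ≤ C₂ ∧ (∀ δ, (RD δ).P = Literature.Probability.RandomPlanarGeometry.SAW.law D.carrier δ (a δ) (b δ) ∧ (RD δ).κ = 8/3 ∧ (RD δ).C₁ ≤ C₁ ∧ (RD δ).C₂ ≤ C₂ ∧ (RD δ).drv = fun γ => (⟨Literature.Probability.RandomPlanarGeometry.drivingFunction φ (Literature.Probability.RandomPlanarGeometry.CurveClass.mk (att δ γ)), Literature.Probability.RandomPlanarGeometry.continuous_drivingFunction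 φ (Literature.Probability.RandomPlanarGeometry.CurveClass.mk (att δ γ))⟩ : C(NNReal, ℝ))) ∧ Filter.Tendsto (fun δ => (RD δ).δ) (nhdsWithin 0 (Set.Ioi 0)) (nhds 0) ∧ Filter.Tendsto (fun δ => (RD δ).P {ω | ∃ k < N δ, ((RD δ).dval (k+1) ω - (RD δ).dval k ω)^2 + (((RD δ).tcap (k+1) ω : ℝ) - (RD δ).tcap k ω) < (RD δ).δ^2}) (nhdsWithin 0 (Set.Ioi 0)) (nhds 0) ∧ ∀ᶠ δ in nhdsWithin 0 (Set.Ioi 0), ∃ (_ : Fintype (Literature.Probability.RandomPlanarGeometry.SAW.DomainSAW D.carrier δ (a δ) (b δ))), (RD δ).IsValid (N δ) ∧ (8/3 + 2) * (T : ℝ) + 1 ≤ (N δ : ℝ) * (RD δ).δ^2 ∧ (N δ : ℝ) * (RD δ).δ^2 ≤ (8/3 + 2) * (T : ℝ) + 2) :=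
  fun D a b happ φ hφ att hatt T =>
    keyEstimate_of_sampled D a b φ att T (stub_sampledKeyEstimate D a b happ φ hφ att hatt T)

/-! S2 `stub_drivingCoupling` (M): LANDED — `Theorems/SAWReversalUpgradeForwardDrivingDrivingCoupling.lean`
(p158449, `…LswEngine.stub_drivingCoupling`), imported above. -/

/-! S3 `stub_lawOfCoupling` (L): LANDED — `Theorems/SAWReversalUpgradeForwardDrivingLawOfCoupling.lean`
(p159272, `…LswEngine.stub_lawOfCoupling`), imported above. -/

/-! ## Composition (proved; the stubs are used BY NAME) -/

/-- The crux from the stubs: S3 ∘ S2 ∘ S1, S1 itself from S1″, S1″ from S1♮ via G1 (all by name), instance by instance in `(D, a, b, φ, att, T)`. -/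
theorem ForwardDriving_of :
    Summit.CriticalPhenomena.SAWScalingLimit.Theses.SAWReversalUpgrade.ForwardDriving := by
  intro D a b happ φ hφ att hatt T
  exact stub_lawOfCoupling D a b φ att T
    (stub_drivingCoupling D a b φ att T (stub_mesoscopicKeyEstimate D a b happ φ hφ att hatt T))

end Summit.CriticalPhenomena.SAWScalingLimit.Cruxes.ForwardDriving.LswEngine

end
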